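import Summits.BirchSwinnertonDyer.BirchSwinnertonDyer.Theorems.ClassRecordThreeEulerHalvesAtThreeEichlerShimuraTorsionCountJ
import Summits.BirchSwinnertonDyer.BirchSwinnertonDyer.Theorems.ClassRecordThreeEulerHalvesAtThreeCartanCoverPrintClausesDivision
import HarnessLib

/-!
# The torsion-refined Shapiro count over a field `K`, part K: what is LEFT of (SIGᶜ-lift)(ii) — torsion-null cochains mod `n` lift at DIVISION algebras

Helper file (route `ClassRecordThree`, crux `EulerHalvesAtThree`, print residue (SIGᶜ-lift)(ii); seat bsd-idea-10 g24, `--supports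
stmt-BirchSwinnertonDyer-19109 --as helper`). Part J proved the split half of the named fact
`Literature.NumberTheory.Automorphic.parabolicCochain_modLift` (`EichlerShimuraLevelK.parabolicCochain_modLift_split`) and reduced the fact to its
division-algebra clause (`parabolicCochain_modLift_of_division`). The LEAD's `CartanCover.PrintClauses.sigLiftClause_iff_of_forall_isUnit` (file
`…CartanCoverPrintClausesDivision`: `ι(O¹)` has no parabolic element when every non-zero element of `B` is a unit) makes every parabolic clause there
vacuous. Combining the two:

* `parabolicCochain_modLift_of_torsLift` — **(SIGᶜ-lift)(ii) follows from the bare TORSION-NULL LIFTING statement at division algebras**: for every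
  quaternion DIVISION algebra `B` over `ℚ`, every order `O`, every injective real embedding `ι` and every `n ≠ 0`, each additive `ψ : ι(O¹) → ℤ/n`
  killing the elements of finite order is the reduction of an additive `u : ι(O¹) → ℤ` (no parabolic conditions anywhere). In print this is the
  statement that `ι(O¹)/⟨⟨torsion⟩⟩` is a closed-surface group, whose `H₁` is free (Poincaré's polygon theorem ∕ Armstrong); it is displayed inline as
  the hypothesis and NOT asserted.
* `torsLift_of_parabolicCochain_modLift` — conversely the named fact gives the torsion-null lifting statement back (so nothing was lost).
No summit statement is proved; nothing about any curve; BSD is proved for no curve.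

## References
* G. Shimura, *Introduction to the arithmetic theory of automorphic functions* (1971), §8.2 (8.2.6), §9.2 p. 246 [ShimuraIATAF1971].
* A. F. Beardon, *The geometry of discrete groups* (1983), Thm. 10.3.2 [Beardon1983].
-/

set_option linter.dupNamespace false

noncomputable section

open scoped MatrixGroups

namespace Summit.BirchSwinnertonDyer.BirchSwinnertonDyer.Theorems.EichlerShimuraLevelK

open Literature.NumberTheory.Automorphic

/-- **(SIGᶜ-lift)(ii) ⇐ TORSION-NULL LIFTING AT DIVISION ALGEBRAS** (split half: `parabolicCochain_modLift_split`; at a division algebra the parabolic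
clauses are vacuous: `CartanCover.PrintClauses.sigLiftClause_iff_of_forall_isUnit`). [cite: ShimuraIATAF1971, §8.2 (8.2.6), §9.2 p. 246]
[cite: Beardon1983, Thm. 10.3.2] -/
theorem parabolicCochain_modLift_of_torsLift
    (htors : ∀ (B : Type) [Ring B] [Algebra ℚ B] [IsQuaternionAlgebra ℚ B] (O : Submodule ℤ B) (hO : Brandt.IsOrder B O)
      (ι : B →ₐ[ℚ] Matrix (Fin 2) (Fin 2) ℝ), Function.Injective ι → (∀ x : B, x ≠ 0 → IsUnit x) →
      ∀ (n : ℕ), n ≠ 0 → ∀ ψ : normOneUnits ι hO → ZMod n,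
        (∀ γ δ : normOneUnits ι hO, ψ (γ * δ) = ψ γ + ψ δ) →
        (∀ γ : normOneUnits ι hO, IsOfFinOrder γ → ψ γ = 0) →
        ∃ u : normOneUnits ι hO → ℤ,
          (∀ γ δ : normOneUnits ι hO, u (γ * δ) = u γ + u δ) ∧ ∀ γ : normOneUnits ι hO, (u γ : ZMod n) = ψ γ) :
    parabolicCochain_modLift :=
  parabolicCochain_modLift_of_division fun B _ _ _ O hO ι hι hdiv n hn ↦
    (CartanCover.PrintClauses.sigLiftClause_iff_of_forall_isUnit ι hO hι hdiv n).2 (htors B O hO ι hι hdiv n hn)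

/-- Conversely, the named fact (SIGᶜ-lift)(ii) contains the torsion-null lifting statement at division algebras. [cite: ShimuraIATAF1971, §8.2 (8.2.6)] -/
theorem torsLift_of_parabolicCochain_modLift (h : parabolicCochain_modLift)
    (B : Type) [Ring B] [Algebra ℚ B] [IsQuaternionAlgebra ℚ B] (O : Submodule ℤ B) (hO : Brandt.IsOrder B O)
    (ι : B →ₐ[ℚ] Matrix (Fin 2) (Fin 2) ℝ) (hι : Function.Injective ι) (hdiv : ∀ x : B, x ≠ 0 → IsUnit x)
    (n : ℕ) (hn : n ≠ 0) (ψ : normOneUnits ι hO → ZMod n)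
    (hadd : ∀ γ δ : normOneUnits ι hO, ψ (γ * δ) = ψ γ + ψ δ) (hfin : ∀ γ : normOneUnits ι hO, IsOfFinOrder γ → ψ γ = 0) :
    ∃ u : normOneUnits ι hO → ℤ,
      (∀ γ δ : normOneUnits ι hO, u (γ * δ) = u γ + u δ) ∧ ∀ γ : normOneUnits ι hO, (u γ : ZMod n) = ψ γ :=
  (CartanCover.PrintClauses.sigLiftClause_iff_of_forall_isUnit ι hO hι hdiv n).1 (h B O hO ι hι n hn) ψ hadd hfin

end Summit.BirchSwinnertonDyer.BirchSwinnertonDyer.Theorems.EichlerShimuraLevelK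

end
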